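import Summits.AtomisticToContinuum.Crystallization.Theorems.FreeSplittingCertificatesStrictSplittingRuleP1CellEndpoint
import Summits.AtomisticToContinuum.Crystallization.Theorems.FreeSplittingCertificatesStrictSplittingRuleP1CellRadAll

/-!
# `StrictSplittingRule` (stmt-AtomisticToContinuum-12560): the cell's endpoint WITH THE EXACT COLLAR FLUX and the circumradii discharged — the flux enclosure (FLX) and its data `(QF, F₀, Δ)` leave the kernel statement (P1 interpolant object, part 67)

Route `FreeSplittingCertificates`, crux r3 `StrictSplittingRule` (H12⋆ = `stub_coreJointCoercive`), unit b2b-freesplit-B gen 34.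
VALUE = a SMALLER conditional endpoint.  Part 64 (`coreJointCoercive_cell_of_certificates`) takes, per representative, a flux ENCLOSURE
`(QF, F₀, Δ)` with the certificate-tier hypothesis (FLX) `Σ_T p1FluxQuad₀(T)(V_T) ≤ Vᵀ F₀ V + Σ Δ|V|²` and books `−κ·(Vᵀ F₀ V + Σ Δ|V|²)` in the near
certificate (NC); the generated-data inventory (HOME FAR-LEMMA-SPEC §24 (d)) sized `F₀` at ≈ 1.5·10⁵ rationals per parity — the one object that does
not fit in a tree file.  It is not needed: the EXACT collar flux `Σ_{T ∈ box} p1FluxQuad₀(y_p)(T)(V_T)` is already a kernel object (parts 41–45, 63), and it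
is itself of the shape `p1NearFlux F 0 QF` for the SCATTERED site-pair matrix `F = p1ScatterFL0 (p1FluxMat₀ …) box` (this file: `p1FluxQuad₀_eq_matrix`,
`p1NearFlux_scatter`).  Hence **`coreJointCoercive_cell_of_certificates₂`**: part 64 with
  * (FLX) and the data `QF, F₀, Δ` REMOVED, and (NC) replaced by (NC⁺) `0 ≤ p1NearForm(…, QF := ∅, Δ := 0, F₀ := 0) V − κ·p1ExactFluxSum a h p V` on the
    least-squares constraint set — the near certificate charged with the exact flux.  At the certificate tier (NC⁺) is what HOME CERT §30 establishes:
    the v9 ledgers certify `NEAR − κ(Vᵀ F₀ V + Σ Δ|V|²) ⪰ 0` on the (a,h)-box (grid LDLᵀ + range bound + interpolation) and `tlmi.fluxform-agg/1` certifies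
    the enclosure `Σ_T Q_T(V) ≤ Vᵀ F₀ V + Σ Δ|V|²` uniformly on the box; together these give (NC⁺).  So the kernel statement no longer carries `F₀`;
    the enclosure is a device of the external verification, not part of the hypothesis.
  * the circumradius data `(cT, ρ, ρ₀)` with `hρ, hρ₀` DISCHARGED by the landed circumradius table (`exists_p1CellCenter`, part 32c): `ρ_T = p1CellRho a h T`
    (`a²/3 + ((h² − a²/3)/(2h))²` for the corner tetrahedra, `a²/3 + h²/4` for the octahedron quarters) — so the per-cell budget (B) is now stated with
    the honeycomb's true circumradii, the quantity the interval tier (`cellval.py`, rule v31, HOME CERT §31) computes.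
What is left as hypotheses: the near tables `(M₁, N, M, QT)` with their four side conditions, the far-share data of rule v31 (`w, θ, sv, o, S, wv, θv`)
with theirs, the legs `LEG` with `hwfar`, the free tables `QB/L/U`, `PAYM`, and FIVE certificate-tier statements (B), (S), (TAB), (PAY), (NC⁺).
NOT a proof of H12⋆ (five certificate-tier hypotheses, verified outside the kernel), NOT summit progress.  [folklore]
-/

noncomputable section

open Set Function Metric MeasureTheory Filter Topology
open scoped BigOperators NNReal ENNReal Classical

namespace Summit.AtomisticToContinuum.Crystallization.Theorems.StrictSplittingRuleBirth

open Literature.MathematicalPhysics.StatisticalMechanics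
open Summit.AtomisticToContinuum.Crystallization.Theorems.PalmUnimodularRigidity.LayeredLawsSelectHcp

/-! ## The re-centred cell flux form as an explicit `12 × 12` matrix -/

/-- The `12 × 12` coefficient matrix of the RE-CENTRED cell flux form `p1FluxQuad₀(y₀)` (index `p = (m, k)`: vertex `m`, component `k`):
`[k = l]·a·A⁰_T(m₁,m₂) + (b+c)·B⁰_T(m₁,m₂,k,l) + n·(∂_kλ_{m₂}·C⁰_T(m₁,l) − ∂_kλ_{m₁}·C⁰_T(m₂,l))`. [folklore] -/
def p1FluxMat₀ (S1 S2 ca cb cc cn a h : ℝ) (y₀ : Fin 3 → ℝ) (i : (ℤ × ℤ × ℤ) × Fin 6) (p q : Fin 4 × Fin 3) : ℝ :=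
  (if p.2 = q.2 then ca * p1FluxA₀ S1 S2 a h y₀ i p.1 q.1 else 0) +
    (cb + cc) * p1FluxB₀ S1 S2 a h y₀ i p.1 q.1 p.2 q.2 +
      cn * (p1LamGrad a h i q.1 p.2 * p1FluxC₀ S1 S2 a h y₀ i p.1 q.2 - p1LamGrad a h i p.1 p.2 * p1FluxC₀ S1 S2 a h y₀ i q.1 q.2)

/-- **The re-centred cell flux form is the quadratic form of `p1FluxMat₀`** in the twelve vertex values. -/
theorem p1FluxQuad₀_eq_matrix (S1 S2 ca cb cc cn a h : ℝ) (y₀ : Fin 3 → ℝ) (i : (ℤ × ℤ × ℤ) × Fin 6) (W : Fin 4 → Fin 3 → ℝ) :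
    p1FluxQuad₀ S1 S2 ca cb cc cn a h y₀ i W =
      ∑ p : Fin 4 × Fin 3, ∑ q : Fin 4 × Fin 3, W p.1 p.2 * p1FluxMat₀ S1 S2 ca cb cc cn a h y₀ i p q * W q.1 q.2 := by
  simp only [Fintype.sum_prod_type]
  unfold p1FluxQuad₀ p1FluxCellForm₀ p1FluxMat₀ fpTr
  simp +decide only [Fin.sum_univ_four, Fin.sum_univ_three, Fin.isValue, ite_true, ite_false]
  ring

/-! ## Scattering per-cell matrices to a site-pair matrix -/

/-- Vertex `m` of cell `i = (n, π)`: the lattice index `n + p1VertOff (parity n) π m`. [folklore] -/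
def p1CellVert (i : (ℤ × ℤ × ℤ) × Fin 6) (m : Fin 4) : ℤ × ℤ × ℤ := i.1 + p1VertOff (p1Par i.1) i.2 m

/-- `p1CellVals` reads the value at `p1CellVert`. -/
theorem p1CellVals_eq_p1CellVert (V : ℤ × ℤ × ℤ → (Fin 3 → ℝ)) (i : (ℤ × ℤ × ℤ) × Fin 6) (m : Fin 4) :
    p1CellVals V i m = V (p1CellVert i m) := rfl

/-- **Scattering a family of per-cell `12 × 12` matrices to ONE site-pair matrix**:
`F((q,k),(q',l)) = Σ_{T ∈ C} Σ_{m,m'} [q' = v_T(m')]·[q = v_T(m)]·Q_T((m,k),(m',l))`. [folklore: finite-element assembly] -/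
def p1ScatterFL0 (Q : ((ℤ × ℤ × ℤ) × Fin 6) → (Fin 4 × Fin 3) → (Fin 4 × Fin 3) → ℝ) (C : Finset ((ℤ × ℤ × ℤ) × Fin 6))
    (x x' : (ℤ × ℤ × ℤ) × Fin 3) : ℝ :=
  ∑ j ∈ C ×ˢ (Finset.univ : Finset (Fin 4 × Fin 4)),
    (if x'.1 = p1CellVert j.1 j.2.2 then (1 : ℝ) else 0) * ((if x.1 = p1CellVert j.1 j.2.1 then (1 : ℝ) else 0) * Q j.1 (j.2.1, x.2) (j.2.2, x'.2))

/-- The vertex set of a finite family of cells. [folklore] -/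
def p1ScatterQF (C : Finset ((ℤ × ℤ × ℤ) × Fin 6)) : Finset (ℤ × ℤ × ℤ) :=
  (C ×ˢ (Finset.univ : Finset (Fin 4))).image fun im => p1CellVert im.1 im.2

/-- Vertices of member cells are in the vertex set. -/
theorem p1CellVert_mem_p1ScatterQF {C : Finset ((ℤ × ℤ × ℤ) × Fin 6)} {i : (ℤ × ℤ × ℤ) × Fin 6} (hi : i ∈ C) (m : Fin 4) :
    p1CellVert i m ∈ p1ScatterQF C :=
  Finset.mem_image.2 ⟨(i, m), Finset.mem_product.2 ⟨hi, Finset.mem_univ _⟩, rfl⟩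

/-- **ASSEMBLY IDENTITY**: the flux-enclosure form `p1NearFlux` with the scattered matrix, zero radii and the vertex set IS the sum over the cells of the
per-cell quadratic forms in the vertex values. -/
theorem p1NearFlux_scatter (Q : ((ℤ × ℤ × ℤ) × Fin 6) → (Fin 4 × Fin 3) → (Fin 4 × Fin 3) → ℝ) (C : Finset ((ℤ × ℤ × ℤ) × Fin 6))
    (V : ℤ × ℤ × ℤ → (Fin 3 → ℝ)) :
    p1NearFlux (p1ScatterFL0 Q C) (fun _ => 0) (p1ScatterQF C) V =
      ∑ i ∈ C, ∑ x : Fin 4 × Fin 3, ∑ x' : Fin 4 × Fin 3, p1CellVals V i x.1 x.2 * Q i x x' * p1CellVals V i x'.1 x'.2 := by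
  unfold p1NearFlux
  simp only [zero_mul, Finset.sum_const_zero, add_zero]
  unfold p1ScatterFL0
  simp only [Finset.sum_mul]
  -- pull the cell binder to the front
  simp only [Finset.sum_comm (t := C ×ˢ (Finset.univ : Finset (Fin 4 × Fin 4)))]
  -- push the site binders inside the component binders
  simp only [Finset.sum_comm (s := p1ScatterQF C) (t := (Finset.univ : Finset (Fin 3)))]
  -- evaluate the Kronecker deltas
  simp only [ite_mul, one_mul, zero_mul, Finset.sum_ite_eq', Finset.sum_ite_irrel, Finset.sum_const_zero]
  rw [Finset.sum_product]
  refine Finset.sum_congr rfl fun i hi => ?_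
  simp only [p1CellVert_mem_p1ScatterQF hi, if_true, Fintype.sum_prod_type, p1CellVals_eq_p1CellVert]
  simp only [Finset.sum_comm (s := (Finset.univ : Finset (Fin 4))) (t := (Finset.univ : Finset (Fin 3)))]
  refine Finset.sum_congr rfl fun k _ => Finset.sum_congr rfl fun l _ => Finset.sum_congr rfl fun m _ =>
    Finset.sum_congr rfl fun m' _ => ?_
  ring

/-! ## The cell's objects: collar box, exact collar flux, circumradii -/

/-- The COLLAR BOX of representative `p`: the index box of part 63 (`p1FluxQuad₀_eq_zero_of_not_mem_box`) times the six cell types — every cell whose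
re-centred flux form can be nonzero lies in it (`3a/4 ≤ h ≤ 9a/10`, `R₂ ≤ 27a/5`). [folklore] -/
def p1CollarBox (p : ℤ × ℤ × ℤ) : Finset ((ℤ × ℤ × ℤ) × Fin 6) :=
  (Finset.Icc (p.1 - 15) (p.1 + 15) ×ˢ (Finset.Icc (p.2.1 - 20) (p.2.1 + 20) ×ˢ Finset.Icc (p.2.2 - 14) (p.2.2 + 14))) ×ˢ
    (Finset.univ : Finset (Fin 6))

/-- **THE EXACT COLLAR FLUX** of lattice values `V` at representative `p` (certificate F2, interface `(R₁,R₂) = (81/20·a, 27/5·a)`):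
`Σ_{T ∈ p1CollarBox p} p1FluxQuad₀(y_p)(T)(V_T)` — by part 45 / part 63 this is the far theorem's boundary term `∫ 2χ⟪∇χ, Φ(ṽ)⟫` of the interpolant. [folklore] -/
def p1ExactFluxSum (a h : ℝ) (p : ℤ × ℤ × ℤ) (V : ℤ × ℤ × ℤ → (Fin 3 → ℝ)) : ℝ :=
  ∑ i ∈ p1CollarBox p, p1FluxQuad₀ ((81 / 20 * a) ^ 2) ((27 / 5 * a) ^ 2) (1 / 3) (4 / 3) (-9 / 8) (1 / 8) a h (fun k => hcpSite a h p k) i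
    (p1CellVals V i)

/-- The per-cell matrices of the exact collar flux at representative `p`. [folklore] -/
def p1ExactFluxMat (a h : ℝ) (p : ℤ × ℤ × ℤ) (i : (ℤ × ℤ × ℤ) × Fin 6) : (Fin 4 × Fin 3) → (Fin 4 × Fin 3) → ℝ :=
  p1FluxMat₀ ((81 / 20 * a) ^ 2) ((27 / 5 * a) ^ 2) (1 / 3) (4 / 3) (-9 / 8) (1 / 8) a h (fun k => hcpSite a h p k) i

/-- **The exact collar flux is a flux-enclosure form with zero radii** (scattered matrix over the collar box, vertex set of the box). -/
theorem p1NearFlux_exact (a h : ℝ) (p : ℤ × ℤ × ℤ) (V : ℤ × ℤ × ℤ → (Fin 3 → ℝ)) :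
    p1NearFlux (p1ScatterFL0 (p1ExactFluxMat a h p) (p1CollarBox p)) (fun _ => 0) (p1ScatterQF (p1CollarBox p)) V =
      p1ExactFluxSum a h p V := by
  rw [p1NearFlux_scatter]
  exact Finset.sum_congr rfl fun i _ => (p1FluxQuad₀_eq_matrix _ _ _ _ _ _ _ _ _ i _).symm

/-- With the empty site set and zero data the flux-enclosure form vanishes. -/
theorem p1NearFlux_empty (V : ℤ × ℤ × ℤ → (Fin 3 → ℝ)) :
    p1NearFlux (fun _ _ => 0) (fun _ => 0) ∅ V = 0 := by
  simp only [p1NearFlux, Finset.sum_empty, add_zero]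

/-- **THE CIRCUMRADIUS TABLE as a function**: `ρ_T = a²/3 + ((h² − a²/3)/(2h))²` for the corner tetrahedra (`π ≤ 1`), `a²/3 + h²/4` for the octahedron
quarters (`exists_p1CellCenter`, part 32c). [folklore] -/
def p1CellRho (a h : ℝ) (i : (ℤ × ℤ × ℤ) × Fin 6) : ℝ :=
  if i.2 ≤ 1 then a ^ 2 / 3 + ((h ^ 2 - a ^ 2 / 3) / (2 * h)) ^ 2 else a ^ 2 / 3 + h ^ 2 / 4

/-- A centre within `ρ_T` (squared) of all four vertices exists for every cell. -/
theorem exists_center_p1CellRho (a h : ℝ) (hh : h ≠ 0) (i : (ℤ × ℤ × ℤ) × Fin 6) :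
    ∃ c : Fin 3 → ℝ, ∀ m : Fin 4, fpSq (fun k => hcpSite a h (i.1 + p1VertOff (p1Par i.1) i.2 m) k - c k) ≤ p1CellRho a h i :=
  exists_p1CellCenter a h hh i

/-- The circumradius table is bounded by the sum of its two values. -/
theorem abs_p1CellRho_le (a h : ℝ) (i : (ℤ × ℤ × ℤ) × Fin 6) :
    |p1CellRho a h i| ≤ a ^ 2 / 3 + ((h ^ 2 - a ^ 2 / 3) / (2 * h)) ^ 2 + (a ^ 2 / 3 + h ^ 2 / 4) := by
  unfold p1CellRho
  split_ifs
  · rw [abs_of_nonneg (by positivity)]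
    linarith [sq_nonneg a, sq_nonneg h]
  · rw [abs_of_nonneg (by positivity)]
    nlinarith [sq_nonneg a, sq_nonneg ((h ^ 2 - a ^ 2 / 3) / (2 * h))]

/-! ## The endpoint with the exact flux -/

/-- **THE CELL'S ENDPOINT WITH THE EXACT COLLAR FLUX** (and the circumradii discharged).  See the module docstring.
NOT a proof of H12⋆ ((B), (S), (TAB), (PAY), (NC⁺) are hypotheses verified outside the kernel), NOT summit progress. -/
theorem coreJointCoercive_cell_of_certificates₂ {a h : ℝ} (ha : 0 < a) (hh : 0 < h) (hfam : HcpFamilyMin a h)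
    (M₁ N M : Bool → (ℤ × ℤ × ℤ) → (ℤ × ℤ × ℤ) → (ℤ × ℤ × ℤ) → ℝ)
    (hMN₁ : ∀ b d s s', s ∉ p1BondOffsets ∨ s' ∉ p1BondOffsets → M₁ b d s s' = 0 ∧ N b d s s' = 0)
    {C₁ : ℝ} (hdec₁ : ∀ p q : ℤ × ℤ × ℤ, ∀ s s', |M₁ (decide (Even p.1)) (q - p) s s'| ≤
        C₁ * ((1 + ‖hcpSite a h q - hcpSite a h p‖)⁻¹) ^ 6 ∧
      |N (decide (Even p.1)) (q - p) s s'| ≤ C₁ * ((1 + ‖hcpSite a h q - hcpSite a h p‖)⁻¹) ^ 6)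
    (hM : ∀ b e s s', M b e s s' = M₁ b e s s' + (fun b e s s' => if s = s' then -((193 / 125) * (2 / 5) / a ^ 4 * p1RecTable a h (p1SplitDensity (81 / 20 * a) (27 / 5 * a)) b e s) else 0) b e s s')
    -- per representative: in-layer far shares and their allocation table
    (w : (ℤ × ℤ × ℤ) → (ℤ × ℤ × ℤ) × (ℤ × ℤ × ℤ) → ℝ) (hw : ∀ p e, 0 ≤ w p e)
    (hws : ∀ p ∈ ({(0, 0, 0), (1, 0, 0)} : Finset (ℤ × ℤ × ℤ)),
      Summable fun e : (ℤ × ℤ × ℤ) × (ℤ × ℤ × ℤ) => w p e * fpSq (fun k => hcpSite a h (e.1 + e.2) k - hcpSite a h e.1 k))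
    (θ : (ℤ × ℤ × ℤ) → (ℤ × ℤ × ℤ) × (ℤ × ℤ × ℤ) → (ℤ × ℤ × ℤ) × Fin 6 → ℝ) (hθ : ∀ p e T, 0 ≤ θ p e T)
    (hfinE : ∀ p e, (Function.support (θ p e)).Finite) (hfinC : ∀ p T, (Function.support fun e => θ p e T).Finite)
    (hsum : ∀ p e, w p e ≠ 0 → ∑ᶠ T, θ p e T = 1)
    (hcar : ∀ p e T, θ p e T ≠ 0 → ∃ m m' : Fin 4, e.1 = T.1 + p1VertOff (p1Par T.1) T.2 m ∧
      e.1 + e.2 = T.1 + p1VertOff (p1Par T.1) T.2 m')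
    -- per representative: vertical far shares, routing offsets and their allocation table
    (sv : (ℤ × ℤ × ℤ) → ℤ × ℤ × ℤ) (o : (ℤ × ℤ × ℤ) → (ℤ × ℤ × ℤ) → Fin 3 → ℤ × ℤ × ℤ) (S : Finset (ℤ × ℤ × ℤ))
    (ho : ∀ p q i, o p q i ∈ S)
    (wv : (ℤ × ℤ × ℤ) → (ℤ × ℤ × ℤ) → ℝ) (hwv : ∀ p q, 0 ≤ wv p q) (hwvs : ∀ p, Summable (wv p))
    (θv : (ℤ × ℤ × ℤ) → (ℤ × ℤ × ℤ) × (ℤ × ℤ × ℤ) → (ℤ × ℤ × ℤ) × Fin 6 → ℝ) (hθv : ∀ p e T, 0 ≤ θv p e T)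
    (hfinEv : ∀ p e, (Function.support (θv p e)).Finite) (hfinCv : ∀ p T, (Function.support fun e => θv p e T).Finite)
    (hsumv : ∀ p e, (∑ i : Fin 3, (2 / 3) * ((if e.2 = o p e.1 i then wv p e.1 else 0) +
        (if o p (e.1 - (sv p - e.2)) i = sv p - e.2 then wv p (e.1 - (sv p - e.2)) else 0))) ≠ 0 → ∑ᶠ T, θv p e T = 1)
    (hcarv : ∀ p e T, θv p e T ≠ 0 → ∃ m m' : Fin 4, e.1 = T.1 + p1VertOff (p1Par T.1) T.2 m ∧
      e.1 + e.2 = T.1 + p1VertOff (p1Par T.1) T.2 m')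
    -- THE PER-CELL BUDGET (B) at each representative, dyad form, weights re-centred at `y_p`
    (hB : ∀ p ∈ ({(0, 0, 0), (1, 0, 0)} : Finset (ℤ × ℤ × ℤ)), ∀ (T : (ℤ × ℤ × ℤ) × Fin 6) (G : Fin 3 → Fin 3 → ℝ),
      (∑ᶠ e : (ℤ × ℤ × ℤ) × (ℤ × ℤ × ℤ), θ p e T * w p e *
          fpSq (fun k => (hcpSite a h (e.1 + e.2) 0 - hcpSite a h e.1 0) * G 0 k +
            (hcpSite a h (e.1 + e.2) 1 - hcpSite a h e.1 1) * G 1 k + (hcpSite a h (e.1 + e.2) 2 - hcpSite a h e.1 2) * G 2 k)) +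
      (∑ᶠ e : (ℤ × ℤ × ℤ) × (ℤ × ℤ × ℤ), θv p e T *
          (∑ i : Fin 3, (2 / 3) * ((if e.2 = o p e.1 i then wv p e.1 else 0) +
            (if o p (e.1 - (sv p - e.2)) i = sv p - e.2 then wv p (e.1 - (sv p - e.2)) else 0))) *
          fpSq (fun k => (hcpSite a h (e.1 + e.2) 0 - hcpSite a h e.1 0) * G 0 k +
            (hcpSite a h (e.1 + e.2) 1 - hcpSite a h e.1 1) * G 1 k + (hcpSite a h (e.1 + e.2) 2 - hcpSite a h e.1 2) * G 2 k)) +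
      (∫ y in p1RealCell a h T, (193 / 125) * ((7 * (5 / 4 : ℝ) + 3 / 4) / 4) * fpChi ((81 / 20 * a) ^ 2) ((27 / 5 * a) ^ 2) (y - fun k => hcpSite a h p k) ^ 2 *
          (fpSq (y - fun k => hcpSite a h p k))⁻¹ ^ 4) * (p1CellRho a h T * fpFrob G) ≤
      (193 / 125) * ((5 / 2 * (1 / 24 * fpSymSq G) + 5 / 2 * (1 / 24 * (fpFrob G - fpSymSq G))) *
        ∫ y in p1RealCell a h T, fpChi ((81 / 20 * a) ^ 2) ((27 / 5 * a) ^ 2) (y - fun k => hcpSite a h p k) ^ 2 * (fpSq (y - fun k => hcpSite a h p k))⁻¹ ^ 3))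
    -- (S) per-site domination off the reach set, (TAB) the hat-average tables on it
    (QB : (ℤ × ℤ × ℤ) → Finset (ℤ × ℤ × ℤ)) (L U : (ℤ × ℤ × ℤ) → (ℤ × ℤ × ℤ) → ℝ)
    (hS : ∀ p ∈ ({(0, 0, 0), (1, 0, 0)} : Finset (ℤ × ℤ × ℤ)), ∀ q : ℤ × ℤ × ℤ, q ∉ QB p → q ≠ p → ∀ z : Fin 3 → ℝ,
      0 ≤ 1 / 2 * (ljSqDeriv (‖hcpSite a h q - hcpSite a h p‖ ^ 2) * fpSq z +
          2 * (1 / 2 * (7 * ((‖hcpSite a h q - hcpSite a h p‖ ^ 2)⁻¹) ^ 8 -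
            4 * ((‖hcpSite a h q - hcpSite a h p‖ ^ 2)⁻¹) ^ 5)) * p1NRad a h p (fun _ => z) q ^ 2) +
        p1SiteBare a h (fun y k l => (193 / 125) * ((7 * (5 / 4 : ℝ) + 3 / 4) / 4) * fpChi ((81 / 20 * a) ^ 2) ((27 / 5 * a) ^ 2) (y - fun k => hcpSite a h p k) ^ 2 *
          (fpSq (y - fun k => hcpSite a h p k))⁻¹ ^ 5 * ((y - fun k => hcpSite a h p k) k * (y - fun k => hcpSite a h p k) l)) (fun _ => z) q -
        p1SiteBare a h (fun y k l => (193 / 125) * ((3 / 4 : ℝ) / 4) * fpChi ((81 / 20 * a) ^ 2) ((27 / 5 * a) ^ 2) (y - fun k => hcpSite a h p k) ^ 2 *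
          (fpSq (y - fun k => hcpSite a h p k))⁻¹ ^ 4 * (if k = l then 1 else 0)) (fun _ => z) q)
    (hTab : ∀ p ∈ ({(0, 0, 0), (1, 0, 0)} : Finset (ℤ × ℤ × ℤ)), ∀ q ∈ QB p, q ≠ p → ∀ z : Fin 3 → ℝ,
      L p q * p1NRad a h p (fun _ => z) q ^ 2 ≤
        p1SiteBare a h (fun y k l => (193 / 125) * ((7 * (5 / 4 : ℝ) + 3 / 4) / 4) * fpChi ((81 / 20 * a) ^ 2) ((27 / 5 * a) ^ 2) (y - fun k => hcpSite a h p k) ^ 2 *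
          (fpSq (y - fun k => hcpSite a h p k))⁻¹ ^ 5 * ((y - fun k => hcpSite a h p k) k * (y - fun k => hcpSite a h p k) l)) (fun _ => z) q ∧
      p1SiteBare a h (fun y k l => (193 / 125) * ((3 / 4 : ℝ) / 4) * fpChi ((81 / 20 * a) ^ 2) ((27 / 5 * a) ^ 2) (y - fun k => hcpSite a h p k) ^ 2 *
          (fpSq (y - fun k => hcpSite a h p k))⁻¹ ^ 4 * (if k = l then 1 else 0)) (fun _ => z) q ≤ U p q * fpSq z)
    -- the near tables vanish off QT
    (QT : (ℤ × ℤ × ℤ) → Finset (ℤ × ℤ × ℤ))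
    (hQT : ∀ p ∈ ({(0, 0, 0), (1, 0, 0)} : Finset (ℤ × ℤ × ℤ)), ∀ q : ℤ × ℤ × ℤ, q ∉ QT p → ∀ s s',
      M₁ (decide (Even p.1)) (q - p) s s' = 0 ∧ M₁ (decide (Even q.1)) (p - q) s s' = 0 ∧
      N (decide (Even p.1)) (q - p) s s' = 0 ∧ N (decide (Even q.1)) (p - q) s' s = 0)
    -- the far shares take at least the full load off LEG
    (LEG : (ℤ × ℤ × ℤ) → Finset ((ℤ × ℤ × ℤ) × (ℤ × ℤ × ℤ)))
    (hwfar : ∀ p ∈ ({(0, 0, 0), (1, 0, 0)} : Finset (ℤ × ℤ × ℤ)), ∀ e : (ℤ × ℤ × ℤ) × (ℤ × ℤ × ℤ), e ∉ LEG p →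
      (if e.1 ≠ p ∧ e.2 ∈ p1Stencil then 1 / 2 * p1Beta a h (decide (Even e.1.1)) (p - e.1) e.2 else 0) ≤ w p e + (if e.2 = sv p then wv p e.1 else 0))
    -- (PAY) the far table's column-sum enclosures
    (PAYM : (ℤ × ℤ × ℤ) → (ℤ × ℤ × ℤ) → ℝ)
    (hPAY : ∀ p ∈ ({(0, 0, 0), (1, 0, 0)} : Finset (ℤ × ℤ × ℤ)), ∀ s ∈ p1BondOffsets, (193 / 125) * (2 / 5) / a ^ 4 *
      (∑' q : ℤ × ℤ × ℤ, p1RecTable a h (p1SplitDensity (81 / 20 * a) (27 / 5 * a)) (decide (Even p.1)) (q - p) s) ≤ PAYM p s)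
    -- (NC⁺) THE NEAR CERTIFICATE WITH THE EXACT COLLAR FLUX on the least-squares constraint set
    (hNC : ∀ p ∈ ({(0, 0, 0), (1, 0, 0)} : Finset (ℤ × ℤ × ℤ)), ∀ V : ℤ × ℤ × ℤ → (Fin 3 → ℝ), V p = 0 →
      (∀ Z : Fin 3 → Fin 3 → ℝ, (∀ j k, Z j k = -Z k j) →
        ∑ q ∈ (if Even p.1 then hcpStarIdx.image (fun d => d + p) else hcpStarIdx.image (fun d => p - d)), ∑ k : Fin 3, V q k * (∑ j : Fin 3, (hcpSite a h q j - hcpSite a h p j) * Z j k) = 0) →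
      0 ≤ p1NearForm a h (1 / 3) (1 / 12) (193 / 125) p p1Stencil (p1Beta a h) M₁ N (w p) (sv p) (wv p) (fun s => -p1Beta a h (decide (Even p.1)) 0 s) (if Even p.1 then hcpStarIdx.image (fun d => d + p) else hcpStarIdx.image (fun d => p - d)) (QB p) (QT p) ∅ (LEG p) (L p) (U p) (PAYM p) (fun _ => 0) (fun _ _ => 0) V -
        193 / 125 * p1ExactFluxSum a h p V) :
    CoreJointCoercive a h (1 / 3) (1 / 12)  := by
  have hh0 : h ≠ 0 := hh.ne'
  refine coreJointCoercive_cell_of_certificates ha hh hfam M₁ N M hMN₁ hdec₁ hM w hw hws θ hθ hfinE hfinC hsum hcar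
    sv o S ho wv hwv hwvs θv hθv hfinEv hfinCv hsumv hcarv
    (fun _ i => Classical.choose (exists_center_p1CellRho a h hh0 i)) (fun _ i => p1CellRho a h i)
    (fun _ i m => Classical.choose_spec (exists_center_p1CellRho a h hh0 i) m)
    (fun _ => a ^ 2 / 3 + ((h ^ 2 - a ^ 2 / 3) / (2 * h)) ^ 2 + (a ^ 2 / 3 + h ^ 2 / 4)) (fun _ i => abs_p1CellRho_le a h i)
    hB QB L U hS hTab QT hQT LEG hwfar PAYM hPAY
    (fun p => p1ScatterQF (p1CollarBox p)) (fun p => p1ScatterFL0 (p1ExactFluxMat a h p) (p1CollarBox p)) (fun _ _ => 0)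
    (fun p _ V => le_of_eq ?_) (fun p hp V hV hmom => ?_)
  · -- (FLX) with equality: the exact collar flux IS the scattered form
    show p1ExactFluxSum a h p V = p1NearFlux (p1ScatterFL0 (p1ExactFluxMat a h p) (p1CollarBox p)) (fun _ => 0) (p1ScatterQF (p1CollarBox p)) V
    rw [p1NearFlux_exact]
  · -- (NC) from (NC⁺)
    have h0 := hNC p hp V hV hmom
    show 0 ≤ p1NearForm a h (1 / 3) (1 / 12) (193 / 125) p p1Stencil (p1Beta a h) M₁ N (w p) (sv p) (wv p)
      (fun s => -p1Beta a h (decide (Even p.1)) 0 s) (if Even p.1 then hcpStarIdx.image (fun d => d + p) else hcpStarIdx.image (fun d => p - d))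
      (QB p) (QT p) (p1ScatterQF (p1CollarBox p)) (LEG p) (L p) (U p) (PAYM p) (fun _ => 0)
      (p1ScatterFL0 (p1ExactFluxMat a h p) (p1CollarBox p)) V
    unfold p1NearForm at h0 ⊢
    rw [p1NearFlux_exact]
    rw [p1NearFlux_empty] at h0
    linarith

end Summit.AtomisticToContinuum.Crystallization.Theorems.StrictSplittingRuleBirth

end
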